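import Summits.AtomisticToContinuum.HydrodynamicLimit.Theorems.TwoClocksClampedEntropyClockEntropyInequalityTensorised
import HarnessLib

/-!
# The entropy inequality across a shared noise factor (first line of the entropy route to the hearts P3Λ/P4Λ; line `Sketch`, crux stmt-11854)

Support file (`--supports stmt-AtomisticToContinuum-11854`).  Any proof of the research hearts
`…LambertianEulerHearts.KineticOneBlockInMeanLambda` / `.CollisionalOneBlockInMeanLambda` by the relative-entropy method starts by
RESTARTING the Lambertian gas `Λ` at the left end `s` of the sub-interval — the law of the window `r ↦ Λ_{s+r}` under
`λ_N ⊗ γ^ℕ` is the law of `r ↦ Λ_r(z′, ξs′)` under `μ_s ⊗ γ^ℕ`, `μ_s` = law of `Λ_s` (law semigroup p120622 / two-time law p127246)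
— and then paying the entropy `H_N(s) = KL(μ_s ‖ ψ_s)` ONCE against the reference started in local Gibbs `ψ_s ⊗ γ^ℕ` with the same
fresh noise.  The second step is this file: for probability laws `μ, R` on configurations, a shared probability law `γ` of the
noise, a rate `β > 0` and a window functional `F` of (configuration, noise),
`−E_{μ ⊗ γ}[F] ≤ β⁻¹ (KL(μ ‖ R) + log E_{R ⊗ γ}[e^{−βF}])` (`integral_prod_noise_ge`), because `KL(μ ⊗ γ ‖ R ⊗ γ) = KL(μ ‖ R)`
(`klDiv_prod_right_eq`, Mathlib's chain rule `klDiv_compProd_left` at a constant kernel).  What it buys for the hearts (lead c6's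
dissection, `Cruxes/LambertianEuler/Lines/Sketch.md` §c6.3): with `β = γ₀/h` on a window of length `h` the entropy term becomes
`(h/γ₀) H_N(s)` — proportional to the window, as the hearts' allowance `C (s′−s) M` demands — and the dynamical input left is an
exponential moment, at the FIXED rate `γ₀`, of the window TIME-AVERAGE of the clamped current along `Λ` started from the explicit
local Gibbs law `ψ_s` (the Lambertian twin of the board's kinetic window LD).  Lead prover-line-stmt-AtomisticToContinuum-11854-c6-0,
2026-08-17.
-/

noncomputable section

open MeasureTheory ProbabilityTheory InformationTheory
open scoped ENNReal

namespace Summit.AtomisticToContinuum.HydrodynamicLimit.Theorems.LambertianContactSwapLambertianEulerRestartEntropyInequality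

/-- **A shared independent factor does not change the relative entropy**: `KL(μ ⊗ γ ‖ R ⊗ γ) = KL(μ ‖ R)` for finite
measures `μ, R` and a probability law `γ` (Mathlib's chain rule `klDiv_compProd_left` for the constant kernel `γ`). [folklore] -/
theorem klDiv_prod_right_eq {Ω E : Type*} [MeasurableSpace Ω] [MeasurableSpace E]
    (μ R : Measure Ω) [IsFiniteMeasure μ] [IsFiniteMeasure R] (γ : Measure E) [IsProbabilityMeasure γ] :
    klDiv (μ.prod γ) (R.prod γ) = klDiv μ R := by
  rw [← Measure.compProd_const, ← Measure.compProd_const, klDiv_compProd_left]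

/-- **The entropy inequality across a shared noise factor** (registered sub-goal `integral_prod_noise_ge` of stmt-11854).
For probability laws `μ, R` on a measurable space `Ω` with `KL(μ ‖ R) < ∞`, a probability law `γ` on `E`, a rate `β > 0`
and a functional `F : Ω × E → ℝ` that is `μ ⊗ γ`-integrable with `e^{−βF}` `R ⊗ γ`-integrable:
`−∫ F d(μ ⊗ γ) ≤ β⁻¹ (KL(μ ‖ R) + log ∫ e^{−βF} d(R ⊗ γ))`.
Use: `μ` = law of `Λ_s`, `R = ψ_s` the local Gibbs reference, `γ = γ^ℕ` the Lambertian noise, `F` = a window functional of the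
restarted flow, `β = γ₀/h`. [cite: KipnisLandim1999, Appendix 1 §8] -/
theorem integral_prod_noise_ge : ∀ {Ω E : Type} [MeasurableSpace Ω] [MeasurableSpace E]
    (μ R : Measure Ω) [IsProbabilityMeasure μ] [IsProbabilityMeasure R] (γ : Measure E) [IsProbabilityMeasure γ],
    klDiv μ R ≠ ⊤ → ∀ {β : ℝ}, 0 < β → ∀ {F : Ω × E → ℝ}, Integrable F (μ.prod γ) →
    Integrable (fun q => Real.exp (-(β * F q))) (R.prod γ) →
    -(∫ q, F q ∂(μ.prod γ)) ≤ β⁻¹ * ((klDiv μ R).toReal + Real.log (∫ q, Real.exp (-(β * F q)) ∂(R.prod γ))) := by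
  intro Ω E _ _ μ R _ _ γ _ hfin β hβ F hF hexp
  have hfin' : klDiv (μ.prod γ) (R.prod γ) ≠ ⊤ := by rwa [klDiv_prod_right_eq]
  have hg : Integrable (fun q => -(β * F q)) (μ.prod γ) := (hF.const_mul β).neg
  have h := QuenchedCellClock.integral_le_toReal_klDiv_add_log_integral_exp (μ.prod γ) (R.prod γ) hfin' hg hexp
  rw [klDiv_prod_right_eq, integral_neg, integral_const_mul] at h
  rw [le_inv_mul_iff₀ hβ]
  linarith

end Summit.AtomisticToContinuum.HydrodynamicLimit.Theorems.LambertianContactSwapLambertianEulerRestartEntropyInequality
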